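import Summits.NavierStokesRegularity.NavierStokesRegularity.Theorems.TerminalTraceTypeITraceScarL3ApexZoomLimitTools
import HarnessLib

/-!
# The limit of a SEQUENCE of extinct local Type-I ancient solutions vanishes weakly at the top time
# (tool for stub Z4 `stub_caseOneZoom` of the line `radius_dichotomy`, item `TerminalTrace.TypeITraceScarL3`,
# stmt-NavierStokesRegularity-18385)

Seat nsreg-C26-p1 g5 (cell ns-regularity-ideate), `--supports stmt-NavierStokesRegularity-18385`.

* `pairing_modulus_of_class` — the modulus of continuity `A|s − s'| + B|s − s'|^{1/3}` of the pairings
  `s ↦ ∫⟪F(s), φ⟫` of ONE member of the class on `]−ρ², 0[`, with `A, B` EXPLICIT in `ρ`, the class constant `K`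
  (`A(a; 0) ≤ K`, `D(a; 0) ≤ K`) and the bounds of `φ` — i.e. uniform over the class (the tree's
  `NSCylinder.exists_fullMeasure_pairing_modulus` on `Q_ρ(0)`, fed as in `exists_uniform_pairing_modulus_of_bounds`);
* `weakNull_of_seqLimit` — if every `F_j` is in the class with the same `K` and vanishes weakly at the top time, and
  `F_j → w` in `L³(Q_a(0))` for every `a`, then `w` vanishes weakly at the top time (sequence version of my
  `weakNull_of_zoomLimit`: the uniform modulus and the individual vanishing give `|∫⟪F_j(s), φ⟫| ≤ A|s| + B|s|^{1/3}`
  a.e., uniformly in `j`; pass to the limit along an a.e.-convergent subsequence of the pairings).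
WHAT THIS IS NOT: 18385 / NS regularity NOT proved. [cite: Seregin2014, §6.6 (6.6.3)] [cite: EscauriazaSereginSverak2003, §3 (3.13)]
-/

noncomputable section

set_option linter.dupNamespace false

namespace Summit.NavierStokesRegularity.NavierStokesRegularity.Theorems.TypeITraceScarL3

open MeasureTheory Set Function Filter Topology TopologicalSpace Metric InnerProductSpace
open Literature.Analysis.FluidPDE
open scoped NNReal ENNReal RealInnerProductSpace Laplacian

set_option maxHeartbeats 1600000 in
/-- **The pairing modulus of one member of the class, with explicit constants** (Temam 1977/79, Ch. III §3
(3.40)–(3.43); ESS 2003, §3 (3.13)): if `(F, P)` is suitable in `Q_ρ(0)` with `A(ρ; 0) ≤ K`, `D(ρ; 0) ≤ K`, and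
`φ` is a test field with `tsupport φ ⊆ B(0, ρ)`, `‖Dφ‖ ≤ K₁`, `‖Δφ‖ ≤ K₂`, then on a full-measure set of times of
`]−ρ², 0[` the pairings `∫⟪F(s), φ⟫` have the modulus `A|s − s'| + B|s − s'|^{1/3}` with the displayed `A, B`.
[cite: EscauriazaSereginSverak2003, §3 (3.13)] [cite: Seregin2014, §6.6 Prop. 6.20] -/
theorem pairing_modulus_of_class
    {F : ℝ → EuclideanSpace ℝ (Fin 3) → EuclideanSpace ℝ (Fin 3)} {P : ℝ → EuclideanSpace ℝ (Fin 3) → ℝ}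
    {ρ : ℝ} (hρ : 0 < ρ)
    (hsw : IsSuitableWeakSolutionInBall ρ (0 : ℝ × EuclideanSpace ℝ (Fin 3)) F P)
    {K : ℝ≥0} (hA : cknAEss ρ (0 : ℝ × EuclideanSpace ℝ (Fin 3)) F ≤ K)
    (hD : cknD ρ (0 : ℝ × EuclideanSpace ℝ (Fin 3)) P ≤ K)
    {φ : EuclideanSpace ℝ (Fin 3) → EuclideanSpace ℝ (Fin 3)} (hφ : ContDiff ℝ (⊤ : ℕ∞) φ)
    (hφc : HasCompactSupport φ) (hφρ : tsupport φ ⊆ ball (0 : EuclideanSpace ℝ (Fin 3)) ρ)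
    {K₁ K₂ : ℝ} (hK₁ : ∀ x, ‖fderiv ℝ φ x‖ ≤ K₁) (hK₂ : ∀ x, ‖Δ φ x‖ ≤ K₂) :
    ∃ S : Set ℝ, (∀ᵐ s ∂(volume.restrict (Ioo (-ρ ^ 2) 0)), s ∈ S) ∧ ∀ s ∈ S, ∀ s' ∈ S,
      |(∫ y, ⟪F s y, φ y⟫) - ∫ y, ⟪F s' y, φ y⟫| ≤
        (K₁ * (ENNReal.ofReal ρ * K).toReal + K₂ * ((volume (ball (0 : EuclideanSpace ℝ (Fin 3)) ρ)).toReal +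
            (ENNReal.ofReal ρ * K).toReal)) * |s - s'| +
          3 * K₁ * (((volume (ball (0 : EuclideanSpace ℝ (Fin 3)) ρ)) ^ (1 / 2 : ℝ) *
              (ENNReal.ofReal ρ ^ 2 * K)) ^ (2 / 3 : ℝ)).toReal * |s - s'| ^ (1 / 3 : ℝ) := by
  set Ω : Opens (EuclideanSpace ℝ (Fin 3)) := ⟨ball 0 ρ, isOpen_ball⟩ with hΩdef
  have hΩset : ((Ω : Opens (EuclideanSpace ℝ (Fin 3))) : Set (EuclideanSpace ℝ (Fin 3))) = ball 0 ρ := rfl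
  have hbΩ : Bornology.IsBounded ((Ω : Opens (EuclideanSpace ℝ (Fin 3))) :
      Set (EuclideanSpace ℝ (Fin 3))) := by rw [hΩset]; exact isBounded_ball
  have hηt : Literature.Analysis.FunctionSpaces.IsTestFunctionOn Ω φ := ⟨hφ, hφc, hφρ⟩
  set C : ℝ≥0∞ := ENNReal.ofReal ρ * K with hC
  have hCtop : C ≠ ∞ := ENNReal.mul_ne_top ENNReal.ofReal_ne_top ENNReal.coe_ne_top
  set Cp : ℝ≥0∞ := ENNReal.ofReal ρ ^ 2 * K with hCp
  have hCptop : Cp ≠ ∞ := ENNReal.mul_ne_top (ENNReal.pow_ne_top ENNReal.ofReal_ne_top) ENNReal.coe_ne_top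
  -- the cylinder `]-ρ², 0[ × B(0, ρ) = Q_ρ(0)`
  set a : ℝ := (0 : ℝ × EuclideanSpace ℝ (Fin 3)).1 - ρ ^ 2 with ha
  set b : ℝ := (0 : ℝ × EuclideanSpace ℝ (Fin 3)).1 with hb
  have hab' : Ioo a b = Ioo (-ρ ^ 2) 0 := by
    rw [ha, hb]; show Ioo ((0 : ℝ) - ρ ^ 2) 0 = Ioo (-ρ ^ 2) 0; rw [zero_sub]
  have hcyl : timeCylinder Ω a b = parabolicCylinderOpens ρ (0 : ℝ × EuclideanSpace ℝ (Fin 3)) := rfl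
  have hcyl_set : Ioo a b ×ˢ ((Ω : Opens (EuclideanSpace ℝ (Fin 3))) : Set (EuclideanSpace ℝ (Fin 3))) =
      parabolicCylinder ρ (0 : ℝ × EuclideanSpace ℝ (Fin 3)) := rfl
  have hsol : IsDistributionalNSSolutionOn (timeCylinder Ω a b) 1 0 F P := by
    rw [hcyl]; exact hsw.1.distributional
  -- the sliced `L²` bound
  have hE : ∀ᵐ t ∂(volume.restrict (Ioo a b)),
      ∫⁻ x in ((Ω : Opens (EuclideanSpace ℝ (Fin 3))) : Set (EuclideanSpace ℝ (Fin 3))),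
        ‖F t x‖ₑ ^ 2 ≤ C := by
    rw [hab', hΩset]
    have hAr := hA
    unfold cknAEss at hAr
    simp only [Prod.fst_zero, Prod.snd_zero, zero_sub] at hAr
    have h1 := ENNReal.ae_le_essSup
      (fun t : ℝ => (ENNReal.ofReal ρ)⁻¹ * ∫⁻ x in ball (0 : EuclideanSpace ℝ (Fin 3)) ρ, ‖F t x‖ₑ ^ 2)
      (μ := volume.restrict (Ioo (-ρ ^ 2) 0))
    have hr0 : ENNReal.ofReal ρ ≠ 0 := (ENNReal.ofReal_pos.2 hρ).ne'
    filter_upwards [h1] with t ht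
    have h2 := ht.trans hAr
    calc ∫⁻ x in ball (0 : EuclideanSpace ℝ (Fin 3)) ρ, ‖F t x‖ₑ ^ 2
        = ENNReal.ofReal ρ * ((ENNReal.ofReal ρ)⁻¹ *
            ∫⁻ x in ball (0 : EuclideanSpace ℝ (Fin 3)) ρ, ‖F t x‖ₑ ^ 2) := by
          rw [← mul_assoc, ENNReal.mul_inv_cancel hr0 ENNReal.ofReal_ne_top, one_mul]
      _ ≤ ENNReal.ofReal ρ * K := by gcongr
  -- the pressure bound
  have hP : ∫⁻ z in Ioo a b ×ˢ ((Ω : Opens (EuclideanSpace ℝ (Fin 3))) : Set (EuclideanSpace ℝ (Fin 3))),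
      ‖P z.1 z.2‖ₑ ^ (3 / 2 : ℝ) ≤ Cp := by
    rw [hcyl_set]
    have hρ2 : (ENNReal.ofReal ρ ^ 2) ≠ 0 := pow_ne_zero _ ((ENNReal.ofReal_pos.2 hρ).ne')
    have hρ2' : (ENNReal.ofReal ρ ^ 2) ≠ ∞ := ENNReal.pow_ne_top ENNReal.ofReal_ne_top
    have hDr := hD
    rw [cknD] at hDr
    exact (ENNReal.inv_mul_le_iff hρ2 hρ2').1 hDr
  -- ## the modulus
  obtain ⟨S, hS, hmod⟩ := NSCylinder.exists_fullMeasure_pairing_modulus hsol hbΩ hCtop hCptop hE hP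
    hηt hK₁ hK₂
  refine ⟨S, by rw [← hab']; exact hS, fun s hs s' hs' => ?_⟩
  have h1 := hmod s hs s' hs'
  rw [hΩset, ← integral_inner_eq_setIntegral_of_tsupport hφρ,
    ← integral_inner_eq_setIntegral_of_tsupport hφρ] at h1
  exact h1

set_option maxHeartbeats 1600000 in
/-- **The `L³` limit of a sequence of extinct class members vanishes weakly at the top time** (Seregin 2014, §6.6
(6.6.3); ESS 2003, §3 (3.13), for a SEQUENCE): the uniform pairing modulus (`pairing_modulus_of_class`, same class
constant `K` for every member) and the weak top-vanishing of each member give `|∫⟪F_j(s), φ⟫| ≤ A|s| + B|s|^{1/3}`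
for a.e. `s ∈ ]−ρ², 0[`, uniformly in `j`; the bound passes to the `L³(Q_ρ)` limit along an a.e.-convergent
subsequence of the pairings. [cite: Seregin2014, §6.6 (6.6.3)] [cite: EscauriazaSereginSverak2003, §3 (3.13)] -/
theorem weakNull_of_seqLimit
    {F : ℕ → ℝ → EuclideanSpace ℝ (Fin 3) → EuclideanSpace ℝ (Fin 3)} {P : ℕ → ℝ → EuclideanSpace ℝ (Fin 3) → ℝ}
    (hsw : ∀ j (a : ℝ), 0 < a →
      IsSuitableWeakSolutionInBall a (0 : ℝ × EuclideanSpace ℝ (Fin 3)) (F j) (P j))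
    {K : ℝ≥0}
    (hA : ∀ j (a : ℝ), 0 < a → cknAEss a (0 : ℝ × EuclideanSpace ℝ (Fin 3)) (F j) ≤ K)
    (hD : ∀ j (a : ℝ), 0 < a → cknD a (0 : ℝ × EuclideanSpace ℝ (Fin 3)) (P j) ≤ K)
    (htop : ∀ j, ∀ φ : EuclideanSpace ℝ (Fin 3) → EuclideanSpace ℝ (Fin 3), ContDiff ℝ (⊤ : ℕ∞) φ →
      HasCompactSupport φ → ∀ ε : ℝ, 0 < ε →
        ∃ s₀ : ℝ, s₀ < 0 ∧ ∀ᵐ s ∂(volume.restrict (Ioo s₀ 0)), |∫ y, ⟪F j s y, φ y⟫| ≤ ε)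
    {w : ℝ → EuclideanSpace ℝ (Fin 3) → EuclideanSpace ℝ (Fin 3)}
    (hF3 : ∀ a : ℝ, 0 < a → ∀ j, MemLp (uncurry (F j)) 3
      (volume.restrict (parabolicCylinder a (0 : ℝ × EuclideanSpace ℝ (Fin 3)))))
    (hw3 : ∀ a : ℝ, 0 < a → MemLp (uncurry w) 3
      (volume.restrict (parabolicCylinder a (0 : ℝ × EuclideanSpace ℝ (Fin 3)))))
    (hconv : ∀ a : ℝ, 0 < a → Tendsto (fun j => eLpNorm (uncurry (F j) - uncurry w) 3
        (volume.restrict (parabolicCylinder a (0 : ℝ × EuclideanSpace ℝ (Fin 3))))) atTop (𝓝 0)) :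
    ∀ φ : EuclideanSpace ℝ (Fin 3) → EuclideanSpace ℝ (Fin 3), ContDiff ℝ (⊤ : ℕ∞) φ →
      HasCompactSupport φ → ∀ ε : ℝ, 0 < ε →
        ∃ s₀ : ℝ, s₀ < 0 ∧ ∀ᵐ s ∂(volume.restrict (Ioo s₀ 0)), |∫ y, ⟪w s y, φ y⟫| ≤ ε := by
  intro φ hφ hφc ε hε
  -- the support radius `ρ ≥ 1` and the bounds of `φ`
  obtain ⟨Rφ, hRφ⟩ := hφc.isCompact.isBounded.subset_closedBall (0 : EuclideanSpace ℝ (Fin 3))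
  set ρ : ℝ := max 1 (Rφ + 1) with hρdef
  have hρ1 : 1 ≤ ρ := le_max_left _ _
  have hρ : 0 < ρ := one_pos.trans_le hρ1
  have hφρ : tsupport φ ⊆ ball (0 : EuclideanSpace ℝ (Fin 3)) ρ := fun x hx =>
    (closedBall_subset_ball (by rw [hρdef]; exact lt_of_lt_of_le (by linarith) (le_max_right _ _))) (hRφ hx)
  have hφs : ∀ y, y ∉ ball (0 : EuclideanSpace ℝ (Fin 3)) ρ → φ y = 0 := fun y hy =>
    image_eq_zero_of_notMem_tsupport fun h => hy (hφρ h)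
  obtain ⟨Mφ, hMφ⟩ := hφ.continuous.bounded_above_of_compact_support hφc
  have hηt : Literature.Analysis.FunctionSpaces.IsTestFunctionOn (⟨ball 0 ρ, isOpen_ball⟩ : Opens (EuclideanSpace ℝ (Fin 3))) φ :=
    ⟨hφ, hφc, hφρ⟩
  obtain ⟨-, K₁, K₂, -, hK₁, hK₂⟩ := exists_bounds_of_isTestFunctionOn hηt
  have hK₁0 : 0 ≤ K₁ := (norm_nonneg _).trans (hK₁ 0)
  have hK₂0 : 0 ≤ K₂ := (norm_nonneg _).trans (hK₂ 0)
  -- the uniform constants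
  set A : ℝ := K₁ * (ENNReal.ofReal ρ * K).toReal + K₂ * ((volume (ball (0 : EuclideanSpace ℝ (Fin 3)) ρ)).toReal +
    (ENNReal.ofReal ρ * K).toReal) with hAdef
  set B : ℝ := 3 * K₁ * (((volume (ball (0 : EuclideanSpace ℝ (Fin 3)) ρ)) ^ (1 / 2 : ℝ) *
    (ENNReal.ofReal ρ ^ 2 * K)) ^ (2 / 3 : ℝ)).toReal with hBdef
  have hA0 : 0 ≤ A := by positivity
  have hB0 : 0 ≤ B := by positivity
  -- the uniform bound `|∫⟪F_j(s), φ⟫| ≤ A|s| + B|s|^{1/3}` for a.e. `s ∈ ]−ρ², 0[`, every `j`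
  have hunif : ∀ j, ∀ᵐ s ∂(volume.restrict (Ioo (-ρ ^ 2) 0)),
      |∫ y, ⟪F j s y, φ y⟫| ≤ A * |s| + B * |s| ^ (1 / 3 : ℝ) := by
    intro j
    obtain ⟨S, hS, hSS⟩ := pairing_modulus_of_class hρ (hsw j ρ hρ) (hA j ρ hρ) (hD j ρ hρ) hφ hφc hφρ hK₁ hK₂
    have htopj := htop j φ hφ hφc
    -- for every `n` there is `s' ∈ S` with `|s'| ≤ 1/(n+1)` and `|pair(s')| ≤ 1/(n+1)`
    have hgood : ∀ n : ℕ, ∃ s' ∈ S, |s'| ≤ 1 / ((n : ℝ) + 1) ∧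
        |∫ y, ⟪F j s' y, φ y⟫| ≤ 1 / ((n : ℝ) + 1) := by
      intro n
      have hn : (0 : ℝ) < 1 / ((n : ℝ) + 1) := by positivity
      obtain ⟨s₀, hs₀, hs₀ae⟩ := htopj (1 / ((n : ℝ) + 1)) hn
      set b : ℝ := max (max s₀ (-ρ ^ 2)) (-(1 / ((n : ℝ) + 1))) with hbdef
      have hb0 : b < 0 := by
        rw [hbdef]
        refine max_lt (max_lt hs₀ (by nlinarith)) (by linarith)
      have hbs₀ : s₀ ≤ b := (le_max_left _ _).trans (le_max_left _ _)
      have hbρ : -ρ ^ 2 ≤ b := (le_max_right _ _).trans (le_max_left _ _)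
      have hbn : -(1 / ((n : ℝ) + 1)) ≤ b := le_max_right _ _
      have h1 : ∀ᵐ s ∂(volume.restrict (Ioo b 0)), s ∈ S :=
        ae_restrict_of_ae_restrict_of_subset (Ioo_subset_Ioo hbρ le_rfl) hS
      have h2 : ∀ᵐ s ∂(volume.restrict (Ioo b 0)), |∫ y, ⟪F j s y, φ y⟫| ≤ 1 / ((n : ℝ) + 1) :=
        ae_restrict_of_ae_restrict_of_subset (Ioo_subset_Ioo hbs₀ le_rfl) hs₀ae
      have h3 : ∀ᵐ s ∂(volume.restrict (Ioo b 0)), s ∈ Ioo b 0 := ae_restrict_mem measurableSet_Ioo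
      have hne : (volume.restrict (Ioo b 0)) ≠ 0 := by
        rw [Ne, Measure.restrict_eq_zero, Real.volume_Ioo]
        exact (ENNReal.ofReal_pos.2 (by linarith)).ne'
      haveI : (ae (volume.restrict (Ioo b 0))).NeBot := ae_neBot.2 hne
      obtain ⟨s', hs'S, hs'le, hs'mem⟩ := (h1.and (h2.and h3)).exists
      refine ⟨s', hs'S, ?_, hs'le⟩
      rw [abs_of_neg hs'mem.2]
      linarith [hs'mem.1]
    choose sq hsqS hsqabs hsqpair using hgood
    filter_upwards [hS] with s hs
    have hbound : ∀ n : ℕ, |∫ y, ⟪F j s y, φ y⟫| ≤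
        A * |s - sq n| + B * |s - sq n| ^ (1 / 3 : ℝ) + 1 / ((n : ℝ) + 1) := by
      intro n
      have h1 := hSS s hs (sq n) (hsqS n)
      have h2 := hsqpair n
      have htri : |∫ y, ⟪F j s y, φ y⟫| ≤
          |(∫ y, ⟪F j s y, φ y⟫) - ∫ y, ⟪F j (sq n) y, φ y⟫| + |∫ y, ⟪F j (sq n) y, φ y⟫| := by
        have := abs_sub_abs_le_abs_sub (∫ y, ⟪F j s y, φ y⟫) (∫ y, ⟪F j (sq n) y, φ y⟫)
        linarith
      linarith
    have hlim : Tendsto (fun n : ℕ => A * |s - sq n| + B * |s - sq n| ^ (1 / 3 : ℝ) + 1 / ((n : ℝ) + 1))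
        atTop (𝓝 (A * |s| + B * |s| ^ (1 / 3 : ℝ) + 0)) := by
      have hsq0 : Tendsto sq atTop (𝓝 0) := by
        refine squeeze_zero_norm (fun n => ?_) tendsto_one_div_add_atTop_nhds_zero_nat
        rw [Real.norm_eq_abs]
        exact hsqabs n
      have h1 : Tendsto (fun n => |s - sq n|) atTop (𝓝 |s|) := by
        have := (tendsto_const_nhds (x := s)).sub hsq0
        rw [sub_zero] at this
        exact this.abs
      have h2 : Tendsto (fun n => |s - sq n| ^ (1 / 3 : ℝ)) atTop (𝓝 (|s| ^ (1 / 3 : ℝ))) :=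
        h1.rpow_const (Or.inr (by norm_num))
      exact ((h1.const_mul A).add (h2.const_mul B)).add tendsto_one_div_add_atTop_nhds_zero_nat
    have := ge_of_tendsto' hlim hbound
    rwa [add_zero] at this
  -- pass to the limit along a subsequence at a.e. time
  obtain ⟨κ, hκ, hae⟩ := exists_subseq_ae_tendsto_pairing_of_tendsto_eLpNorm (hF3 ρ hρ) (hw3 ρ hρ)
    (hconv ρ hρ) hφ.continuous hMφ hφs
  have hunifκ : ∀ᵐ s ∂(volume.restrict (Ioo (-ρ ^ 2) 0)), ∀ k,
      |∫ y, ⟪F (κ k) s y, φ y⟫| ≤ A * |s| + B * |s| ^ (1 / 3 : ℝ) := by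
    rw [ae_all_iff]; intro k; exact hunif (κ k)
  have hwbound : ∀ᵐ s ∂(volume.restrict (Ioo (-ρ ^ 2) 0)),
      |∫ y, ⟪w s y, φ y⟫| ≤ A * |s| + B * |s| ^ (1 / 3 : ℝ) := by
    filter_upwards [hae, hunifκ] with s hs hsb
    exact le_of_tendsto' hs.abs hsb
  -- choose `s₀`
  set C : ℝ := max A B with hCdef
  have hC0 : 0 ≤ C := hA0.trans (le_max_left _ _)
  obtain ⟨δ, hδ, hδ1, hδC⟩ := SereginSverak2002.exists_delta_modulus_le hC0 hε
  set s₀ : ℝ := max (-δ / 2) (-ρ ^ 2 / 2) with hs₀def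
  have hs₀neg : s₀ < 0 := by
    rw [hs₀def]; exact max_lt (by linarith) (by nlinarith)
  refine ⟨s₀, hs₀neg, ?_⟩
  have hsub : Ioo s₀ 0 ⊆ Ioo (-ρ ^ 2) 0 := Ioo_subset_Ioo (by
    rw [hs₀def]; refine le_trans (by nlinarith) (le_max_right _ _)) le_rfl
  filter_upwards [ae_restrict_of_ae_restrict_of_subset hsub hwbound, ae_restrict_mem measurableSet_Ioo]
    with s hs hsI
  have hsδ : |s| < δ := by
    rw [abs_of_neg hsI.2]
    have : -δ / 2 ≤ s₀ := le_max_left _ _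
    linarith [hsI.1]
  calc |∫ y, ⟪w s y, φ y⟫| ≤ A * |s| + B * |s| ^ (1 / 3 : ℝ) := hs
    _ ≤ C * |s| + C * |s| ^ (1 / 3 : ℝ) := by
        gcongr
        · exact le_max_left _ _
        · exact le_max_right _ _
    _ = C * (|s| + |s| ^ (1 / 3 : ℝ)) := by ring
    _ ≤ ε := hδC s hsδ

end Summit.NavierStokesRegularity.NavierStokesRegularity.Theorems.TypeITraceScarL3

end
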